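import Summits.CriticalPhenomena.PercolationContinuityZ3.Theorems.PercNearOneGluingNoHeavyLowerTailKnQuestion8AntitheticVirtualCrown
import Summits.CriticalPhenomena.PercolationContinuityZ3.Theorems.PercNearOneGluingNoHeavyLowerTailKnQuestion8AntitheticCycleGadget
import HarnessLib

/-!
# `NoHeavyLowerTail` (crux stmt-CriticalPhenomena-4575), antithetic vdBHK programme: THEOREM COβ — a β-CYCLE OF ANY LENGTH on the atoms of a finite
# poset obstructs antipodal Kleitman (the 'if' half of CONJECTURE Cβ, for every finite poset and every k ≥ 3)

Support file (seat `prim-ineq-gen-7` gen 48; `--supports stmt-CriticalPhenomena-4575`).  No `sorry`, no definitions.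
Memo / pencil proof: run/shared/lean/prim/prim-ineq-gen-7/PROOF-COBETA-g48.md (§2 gadget, §3 recursion, §4 virtual crown), FINDING-COBETA-g48.md.
SETTING as in `…AntitheticCrownObstruction` / `…AntitheticVirtualCrown`: `E` a finite partial order, `down`/`hdown`, Λ-labels `lab`/`hlab`
(`0 = RI, 1 = RN, 2 = BN, 3 = BI`), `leL` the Λ-order, `le`/`hle` the labelwise colouring order (`Ω_P`), `ι` = complementation.
A β-CYCLE of length `k ≥ 3`: minimal elements `at 0, …, at (k-1)` and elements `tp i > at i, at (i+1 mod k)` with `tp i` above no other cycle atom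
(`k = 3`: an induced crown on atoms, THEOREM CO; `k = 4`: THEOREM CO₄; the bare cycles `C_2k` for all `k`: g47's inflation lemma).
* `AntitheticBetaCycleObstruction.beta_cycle_obstruction` — **THEOREM COβ**: then there are `le`-up-sets `U, H` with `#(U ∩ H) < #(U ∩ ιH)`.
PROOF.  Contract the path `tp 2, at 3, tp 3, …, at (k-1), tp (k-1)` into a VIRTUAL top over `(at 2, at 0)` by iterating the cycle-shortening gadget
(`AntitheticCycleGadget`: label `W n s` after `n` contractions from the far end, colour `cW n s` = MAJ(top red, next atom BLUE, previous colour)),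
prove by induction on `n` that the virtual label is `< 4`, is `RI`/`BI` exactly when `D_n = ↓tp(k-1-n) ∪ … ∪ ↓tp(k-1)` is all red / all blue, is red iff
`cW n`, is MONOTONE along `Ω_P` (gadget_mono), ι-equivariant (gadget_compl), and that `cW` depends only on the path, is self-dual and red on the all-red
path; then apply the VIRTUAL CROWN LEMMA (`AntitheticVirtualCrown.virtual_crown_obstruction`) to the virtual crown `(at 0, at 1, at 2; tp 0, Z, tp 1)`.
-/

namespace Summit.CriticalPhenomena.PercolationContinuityZ3.Theorems

open Finset

namespace AntitheticBetaCycleObstruction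

variable {E : Type*} [Fintype E] [DecidableEq E] [PartialOrder E]

/-- **THEOREM COβ (β-cycle obstruction, every length).**  Let `P` be a finite poset with minimal elements `at 0, …, at (k-1)` (`k ≥ 3`) and elements
`tp i > at i, at ((i+1) % k)` such that `tp i` lies above no other `at j` (a β-cycle of the atom hypergraph).  With Λ-labels and the colouring order as
in `AntitheticCrownObstruction.crown_obstruction`, `Ω_P` is NOT antipodal Kleitman: there are up-sets `U, H` with `#(U ∩ H) < #(U ∩ ιH)`.
[this work: PROOF-COBETA-g48.md; gadget `AntitheticCycleGadget`, engine `AntitheticVirtualCrown`] -/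
theorem beta_cycle_obstruction
    (down : E → Finset E) (hdown : ∀ d e, d ∈ down e ↔ d < e)
    (lab : (E → Bool) → E → ℕ)
    (hlab : ∀ s e, lab s e = if s e = true then (if ∀ d ∈ down e, s d = true then 0 else 1)
      else (if ∀ d ∈ down e, s d = false then 3 else 2))
    (leL : ℕ → ℕ → Bool)
    (hleL : leL = fun p q => p == q || (p == 0 && q == 1) || (p == 0 && q == 3) || (p == 2 && q == 1) || (p == 2 && q == 3))
    (le : (E → Bool) → (E → Bool) → Prop) (hle : ∀ s t, le s t ↔ ∀ e, leL (lab s e) (lab t e) = true)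
    (k : ℕ) (hk : 3 ≤ k) («at» tp : ℕ → E)
    (hmin : ∀ i, i < k → ∀ d, ¬ d < «at» i)
    (hcov : ∀ i, i < k → «at» i < tp i) (hcov' : ∀ i, i < k → «at» ((i + 1) % k) < tp i)
    (hβ : ∀ i j, i < k → j < k → j ≠ i → j ≠ (i + 1) % k → ¬ «at» j < tp i) :
    ∃ U H : Finset (E → Bool), (∀ s t, le s t → s ∈ U → t ∈ U) ∧ (∀ s t, le s t → s ∈ H → t ∈ H) ∧
      (U ∩ H).card < (U ∩ H.image (fun s => fun e => !s e)).card := by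
  classical
  -- ### indices
  have hk0 : 0 < k := by omega
  have h1k : 1 % k = 1 := Nat.mod_eq_of_lt (by omega)
  have h2k : 2 % k = 2 := Nat.mod_eq_of_lt (by omega)
  have hβ' : ∀ i j, i < k → j < k → j ≠ i → (i + 1 < k → j ≠ i + 1) → (i + 1 = k → j ≠ 0) → ¬ «at» j < tp i := by
    intro i j hi hj h1 h2 h3
    apply hβ i j hi hj h1
    by_cases h : i + 1 < k
    · rw [Nat.mod_eq_of_lt h]; exact h2 h
    · have e : i + 1 = k := by omega
      rw [e, Nat.mod_self]; exact h3 e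
  -- ### the crown part: a = at 0, b = at 1, c = at 2, x = tp 0, z = tp 1
  have hax : «at» 0 < tp 0 := hcov 0 hk0
  have hbx : «at» 1 < tp 0 := by have := hcov' 0 hk0; rwa [Nat.zero_add, h1k] at this
  have hcx : ¬ «at» 2 < tp 0 := hβ' 0 2 hk0 (by omega) (by omega) (fun _ => by omega) (fun h => by omega)
  have hbz : «at» 1 < tp 1 := hcov 1 (by omega)
  have hcz : «at» 2 < tp 1 := by have := hcov' 1 (by omega); rwa [show (1 : ℕ) + 1 = 2 from rfl, h2k] at this
  have haz : ¬ «at» 0 < tp 1 := hβ' 1 0 (by omega) hk0 (by omega) (fun _ => by omega) (fun h => by omega)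
  -- ### the path S and the down-set D of the virtual top
  set S : Finset E := ((Finset.range k).filter (fun i => 2 ≤ i)).image tp ∪ ((Finset.range k).filter (fun i => 3 ≤ i)).image «at» with hS
  have htpS : ∀ i, 2 ≤ i → i < k → tp i ∈ S := by
    intro i h1 h2; rw [hS, Finset.mem_union]; left
    exact Finset.mem_image.2 ⟨i, Finset.mem_filter.2 ⟨Finset.mem_range.2 h2, h1⟩, rfl⟩
  have hatS : ∀ i, 3 ≤ i → i < k → «at» i ∈ S := by
    intro i h1 h2; rw [hS, Finset.mem_union]; right
    exact Finset.mem_image.2 ⟨i, Finset.mem_filter.2 ⟨Finset.mem_range.2 h2, h1⟩, rfl⟩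
  have hS_cases : ∀ e ∈ S, (∃ i, 2 ≤ i ∧ i < k ∧ e = tp i) ∨ (∃ i, 3 ≤ i ∧ i < k ∧ e = «at» i) := by
    intro e he
    rw [hS, Finset.mem_union] at he
    rcases he with he | he
    · obtain ⟨i, hi, rfl⟩ := Finset.mem_image.1 he
      rw [Finset.mem_filter, Finset.mem_range] at hi; exact Or.inl ⟨i, hi.2, hi.1, rfl⟩
    · obtain ⟨i, hi, rfl⟩ := Finset.mem_image.1 he
      rw [Finset.mem_filter, Finset.mem_range] at hi; exact Or.inr ⟨i, hi.2, hi.1, rfl⟩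
  obtain ⟨Dn, hDn⟩ : ∃ Dn : ℕ → Finset E, Dn = fun n => ((Finset.range k).filter (fun i => k - 1 - n ≤ i)).biUnion
      (fun i => Finset.univ.filter (fun e => e ≤ tp i)) := ⟨_, rfl⟩
  have hDn_mem : ∀ n e, e ∈ Dn n ↔ ∃ i, k - 1 - n ≤ i ∧ i < k ∧ e ≤ tp i := by
    intro n e; rw [hDn]
    simp only [Finset.mem_biUnion, Finset.mem_filter, Finset.mem_range, Finset.mem_univ, true_and]
    exact ⟨fun ⟨i, ⟨h1, h2⟩, h3⟩ => ⟨i, h2, h1, h3⟩, fun ⟨i, h2, h1, h3⟩ => ⟨i, ⟨h1, h2⟩, h3⟩⟩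
  set D : Finset E := Dn (k - 3) with hD
  have hD_mem : ∀ e, e ∈ D ↔ ∃ i, 2 ≤ i ∧ i < k ∧ e ≤ tp i := by
    intro e; rw [hD, hDn_mem]
    exact ⟨fun ⟨i, h1, h2, h3⟩ => ⟨i, by omega, h2, h3⟩, fun ⟨i, h1, h2, h3⟩ => ⟨i, by omega, h2, h3⟩⟩
  -- hypotheses of the virtual crown lemma about S and D
  have hSne : S.Nonempty := ⟨tp 2, htpS 2 le_rfl (by omega)⟩
  have haS : «at» 0 ∉ S := by
    intro h
    rcases hS_cases _ h with ⟨i, -, hik, he⟩ | ⟨i, hi3, hik, he⟩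
    · have := hcov i hik; rw [← he] at this; exact hmin 0 hk0 _ this
    · have := hax; rw [he] at this; exact hβ' 0 i hk0 hik (by omega) (fun _ => by omega) (fun _ => by omega) this
  have hcS : «at» 2 ∉ S := by
    intro h
    rcases hS_cases _ h with ⟨i, -, hik, he⟩ | ⟨i, hi3, hik, he⟩
    · have := hcov i hik; rw [← he] at this; exact hmin 2 (by omega) _ this
    · have := hcz; rw [he] at this; exact hβ' 1 i (by omega) hik (by omega) (fun _ => by omega) (fun _ => by omega) this
  have hSx : ∀ d ∈ S, ¬ d < tp 0 := by
    intro d hd hlt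
    rcases hS_cases _ hd with ⟨i, hi2, hik, rfl⟩ | ⟨i, hi3, hik, rfl⟩
    · exact hβ' 0 i hk0 hik (by omega) (fun _ => by omega) (fun _ => by omega) (lt_trans (hcov i hik) hlt)
    · exact hβ' 0 i hk0 hik (by omega) (fun _ => by omega) (fun _ => by omega) hlt
  have hSz : ∀ d ∈ S, ¬ d < tp 1 := by
    intro d hd hlt
    rcases hS_cases _ hd with ⟨i, hi2, hik, rfl⟩ | ⟨i, hi3, hik, rfl⟩
    · have h := lt_trans (hcov' i hik) hlt
      by_cases hi : i + 1 < k
      · rw [Nat.mod_eq_of_lt hi] at h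
        exact hβ' 1 (i + 1) (by omega) hi (by omega) (fun _ => by omega) (fun _ => by omega) h
      · have e : i + 1 = k := by omega
        rw [e, Nat.mod_self] at h; exact haz h
    · exact hβ' 1 i (by omega) hik (by omega) (fun _ => by omega) (fun _ => by omega) hlt
  have hSD : S ⊆ D := by
    intro e he
    rw [hD_mem]
    rcases hS_cases _ he with ⟨i, hi2, hik, rfl⟩ | ⟨i, hi3, hik, rfl⟩
    · exact ⟨i, hi2, hik, le_rfl⟩
    · exact ⟨i, by omega, hik, le_of_lt (hcov i hik)⟩
  have haD : «at» 0 ∈ D := by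
    rw [hD_mem]
    refine ⟨k - 1, by omega, by omega, le_of_lt ?_⟩
    have := hcov' (k - 1) (by omega)
    rwa [Nat.sub_add_cancel (by omega : 1 ≤ k), Nat.mod_self] at this
  have hcD : «at» 2 ∈ D := by rw [hD_mem]; exact ⟨2, le_rfl, by omega, le_of_lt (hcov 2 (by omega))⟩
  have hb_not : ∀ i, 2 ≤ i → i < k → ¬ «at» 1 < tp i :=
    fun i hi2 hik => hβ' i 1 hik (by omega) (by omega) (fun _ => by omega) (fun _ => by omega)
  have hbD : «at» 1 ∉ D := by
    rw [hD_mem]; rintro ⟨i, hi2, hik, hle'⟩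
    rcases hle'.lt_or_eq with hlt | heq
    · exact hb_not i hi2 hik hlt
    · have := hcov i hik; rw [← heq] at this; exact hmin 1 (by omega) _ this
  have hxD : tp 0 ∉ D := by
    rw [hD_mem]; rintro ⟨i, hi2, hik, hle'⟩; exact hb_not i hi2 hik (lt_of_lt_of_le hbx hle')
  have hzD : tp 1 ∉ D := by
    rw [hD_mem]; rintro ⟨i, hi2, hik, hle'⟩; exact hb_not i hi2 hik (lt_of_lt_of_le hbz hle')
  -- ### labels
  set cpl : (E → Bool) → (E → Bool) := fun s => fun e => !s e with hcpl
  have hlab_lt : ∀ s e, lab s e < 4 := by intro s e; rw [hlab]; split_ifs <;> omega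
  have hlab0 : ∀ s e, lab s e = 0 ↔ ∀ d, d ≤ e → s d = true := by
    intro s e; rw [hlab]
    constructor
    · intro h
      by_cases hs : s e = true
      · by_cases q1 : ∀ d ∈ down e, s d = true
        · intro d hd
          rcases hd.lt_or_eq with hd | rfl
          · exact q1 d ((hdown d e).2 hd)
          · exact hs
        · rw [if_pos hs, if_neg q1] at h; omega
      · by_cases q2 : ∀ d ∈ down e, s d = false
        · rw [if_neg hs, if_pos q2] at h; omega
        · rw [if_neg hs, if_neg q2] at h; omega
    · intro h
      rw [if_pos (h e le_rfl), if_pos (fun d hd => h d (le_of_lt ((hdown d e).1 hd)))]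
  have hlab3 : ∀ s e, lab s e = 3 ↔ ∀ d, d ≤ e → s d = false := by
    intro s e; rw [hlab]
    constructor
    · intro h
      by_cases hs : s e = true
      · by_cases q1 : ∀ d ∈ down e, s d = true
        · rw [if_pos hs, if_pos q1] at h; omega
        · rw [if_pos hs, if_neg q1] at h; omega
      · by_cases q2 : ∀ d ∈ down e, s d = false
        · intro d hd
          rcases hd.lt_or_eq with hd | rfl
          · exact q2 d ((hdown d e).2 hd)
          · simpa using hs
        · rw [if_neg hs, if_neg q2] at h; omega
    · intro h
      have h0 : ¬ s e = true := by rw [h e le_rfl]; exact Bool.false_ne_true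
      rw [if_neg h0, if_pos (fun d hd => h d (le_of_lt ((hdown d e).1 hd)))]
  have hlab_red : ∀ s e, decide (lab s e < 2) = s e := by
    intro s e; rw [hlab]; cases s e <;> simp <;> split_ifs <;> omega
  have hlab_cpl : ∀ s e, lab (cpl s) e = 3 - lab s e := by
    intro s e
    have e1 : (∀ d ∈ down e, cpl s d = true) ↔ (∀ d ∈ down e, s d = false) := by simp [hcpl]
    have e2 : (∀ d ∈ down e, cpl s d = false) ↔ (∀ d ∈ down e, s d = true) := by simp [hcpl]
    have e3 : (cpl s e = true) ↔ ¬ (s e = true) := by simp [hcpl]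
    rw [hlab (cpl s) e, hlab s e, if_congr e3 (if_congr e1 rfl rfl) (if_congr e2 rfl rfl)]
    by_cases h0 : s e = true
    · rw [if_neg (not_not.2 h0), if_pos h0]
      by_cases h1 : (∀ d ∈ down e, s d = true)
      · rw [if_pos h1, if_pos h1]
      · rw [if_neg h1, if_neg h1]
    · rw [if_pos h0, if_neg h0]
      by_cases h2 : (∀ d ∈ down e, s d = false)
      · rw [if_pos h2, if_pos h2]
      · rw [if_neg h2, if_neg h2]
  have hlab_atom : ∀ s i, i < k → lab s («at» i) = if s («at» i) = true then 0 else 3 := by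
    intro s i hi
    rw [hlab, if_pos (fun d hd => (hmin i hi d ((hdown d _).1 hd)).elim), if_pos (fun d hd => (hmin i hi d ((hdown d _).1 hd)).elim)]
  have hatom_mono : ∀ s t, le s t → ∀ i, i < k → t («at» i) = true → s («at» i) = true := by
    intro s t hst i hi ht
    rw [hle] at hst
    have h := hst («at» i)
    rw [hlab_atom s i hi, hlab_atom t i hi, ht, hleL] at h
    revert h; cases s («at» i) <;> simp
  -- the atom of the window below the window's first top
  have hcovW : ∀ n, n + 3 ≤ k → «at» (k - 1 - n) < tp (k - 2 - n) := by
    intro n hn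
    have := hcov' (k - 2 - n) (by omega)
    rwa [Nat.mod_eq_of_lt (by omega : k - 2 - n + 1 < k), show k - 2 - n + 1 = k - 1 - n from by omega] at this
  have hreal0 : ∀ s n, n + 3 ≤ k → lab s (tp (k - 2 - n)) = 0 → s («at» (k - 1 - n)) = true :=
    fun s n hn h => (hlab0 s _).1 h _ (le_of_lt (hcovW n hn))
  have hreal3 : ∀ s n, n + 3 ≤ k → lab s (tp (k - 2 - n)) = 3 → s («at» (k - 1 - n)) = false :=
    fun s n hn h => (hlab3 s _).1 h _ (le_of_lt (hcovW n hn))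
  -- ### the gadget, the iterated virtual label W n and its colour cW n (n contractions from the far end of the path)
  obtain ⟨gad, hgad⟩ : ∃ gad : ℕ → Bool → ℕ → ℕ, gad = fun L1 m L2 => if m = true then (if L1 = 0 ∧ L2 = 0 then 0 else if L1 = 2 ∨ L2 = 2 then 2 else 1)
      else (if L1 = 3 ∧ L2 = 3 then 3 else if L1 = 1 ∨ L2 = 1 then 1 else 2) := ⟨_, rfl⟩
  obtain ⟨maj, hmaj⟩ : ∃ maj : Bool → Bool → Bool → Bool, maj = fun p q r => (p && q) || (p && r) || (q && r) := ⟨_, rfl⟩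
  obtain ⟨W, hW0, hWs⟩ : ∃ W : ℕ → (E → Bool) → ℕ, (∀ s, W 0 s = lab s (tp (k - 1))) ∧
      (∀ n s, W (n + 1) s = gad (lab s (tp (k - 2 - n))) (s («at» (k - 1 - n))) (W n s)) :=
    ⟨fun n => Nat.rec (motive := fun _ => (E → Bool) → ℕ) (fun s => lab s (tp (k - 1)))
      (fun n r => fun s => gad (lab s (tp (k - 2 - n))) (s («at» (k - 1 - n))) (r s)) n, fun s => rfl, fun n s => rfl⟩
  obtain ⟨cW, hcW0, hcWs⟩ : ∃ cW : ℕ → (E → Bool) → Bool, (∀ s, cW 0 s = s (tp (k - 1))) ∧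
      (∀ n s, cW (n + 1) s = maj (s (tp (k - 2 - n))) (!s («at» (k - 1 - n))) (cW n s)) :=
    ⟨fun n => Nat.rec (motive := fun _ => (E → Bool) → Bool) (fun s => s (tp (k - 1)))
      (fun n r => fun s => maj (s (tp (k - 2 - n))) (!s («at» (k - 1 - n))) (r s)) n, fun s => rfl, fun n s => rfl⟩
  have hGval := AntitheticCycleGadget.gadget_values gad hgad
  have hGmono := AntitheticCycleGadget.gadget_mono leL hleL gad hgad
  have hGcpl := AntitheticCycleGadget.gadget_compl gad hgad
  have hGred := AntitheticCycleGadget.gadget_red gad hgad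
  -- D_n facts
  have hDn0 : ∀ e, e ∈ Dn 0 ↔ e ≤ tp (k - 1) := by
    intro e; rw [hDn_mem]
    constructor
    · rintro ⟨i, h1, h2, h3⟩
      have hi : i = k - 1 := by omega
      rw [hi] at h3; exact h3
    · exact fun h => ⟨k - 1, by omega, by omega, h⟩
  have hDn_succ : ∀ n e, n + 4 ≤ k → (e ∈ Dn (n + 1) ↔ e ≤ tp (k - 2 - n) ∨ e ∈ Dn n) := by
    intro n e hn; rw [hDn_mem, hDn_mem]
    constructor
    · rintro ⟨i, h1, h2, h3⟩
      by_cases hi : i = k - 2 - n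
      · left; rw [hi] at h3; exact h3
      · right; exact ⟨i, by omega, h2, h3⟩
    · rintro (h | ⟨i, h1, h2, h3⟩)
      · exact ⟨k - 2 - n, by omega, by omega, h⟩
      · exact ⟨i, by omega, h2, h3⟩
  have hat_Dn : ∀ n, n + 3 ≤ k → «at» (k - 1 - n) ∈ Dn n := by
    intro n hn; rw [hDn_mem]; exact ⟨k - 1 - n, le_rfl, by omega, le_of_lt (hcov _ (by omega))⟩
  -- (Ia/Ib) range and interior values of W n
  have hWval : ∀ n, n + 3 ≤ k → ∀ s, W n s < 4 ∧ (W n s = 0 ↔ ∀ d ∈ Dn n, s d = true) ∧ (W n s = 3 ↔ ∀ d ∈ Dn n, s d = false) := by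
    intro n
    induction n with
    | zero =>
      intro _ s
      rw [hW0]
      refine ⟨hlab_lt s _, ?_, ?_⟩
      · rw [hlab0]; exact ⟨fun h d hd => h d ((hDn0 d).1 hd), fun h d hd => h d ((hDn0 d).2 hd)⟩
      · rw [hlab3]; exact ⟨fun h d hd => h d ((hDn0 d).1 hd), fun h d hd => h d ((hDn0 d).2 hd)⟩
    | succ n ih =>
      intro hn s
      obtain ⟨ihlt, ih0, ih3⟩ := ih (by omega) s
      rw [hWs]
      have hv := hGval (s («at» (k - 1 - n))) ⟨lab s (tp (k - 2 - n)), hlab_lt s _⟩ ⟨W n s, ihlt⟩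
        (fun h => hreal0 s n (by omega) h) (fun h => ih3.1 h _ (hat_Dn n (by omega)))
      simp only at hv
      obtain ⟨hlt4, h0, h3⟩ := hv
      refine ⟨hlt4, ?_, ?_⟩
      · rw [h0, hlab0, ih0]
        constructor
        · rintro ⟨h1, h2⟩ d hd
          rcases (hDn_succ n d hn).1 hd with hd | hd
          exacts [h1 d hd, h2 d hd]
        · intro h
          exact ⟨fun d hd => h d ((hDn_succ n d hn).2 (Or.inl hd)), fun d hd => h d ((hDn_succ n d hn).2 (Or.inr hd))⟩
      · rw [h3, hlab3, ih3]
        constructor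
        · rintro ⟨h1, h2⟩ d hd
          rcases (hDn_succ n d hn).1 hd with hd | hd
          exacts [h1 d hd, h2 d hd]
        · intro h
          exact ⟨fun d hd => h d ((hDn_succ n d hn).2 (Or.inl hd)), fun d hd => h d ((hDn_succ n d hn).2 (Or.inr hd))⟩
  have hWreal0 : ∀ n, n + 3 ≤ k → ∀ s, W n s = 0 → s («at» (k - 1 - n)) = true :=
    fun n hn s h => ((hWval n hn s).2.1.1 h) _ (hat_Dn n hn)
  have hWreal3 : ∀ n, n + 3 ≤ k → ∀ s, W n s = 3 → s («at» (k - 1 - n)) = false :=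
    fun n hn s h => ((hWval n hn s).2.2.1 h) _ (hat_Dn n hn)
  -- (Ic) the colour of W n is cW n
  have hWred : ∀ n, n + 3 ≤ k → ∀ s, decide (W n s < 2) = cW n s := by
    intro n
    induction n with
    | zero => intro _ s; rw [hW0, hcW0, hlab_red]
    | succ n ih =>
      intro hn s
      rw [hWs, hcWs]
      have hv := hGred (s («at» (k - 1 - n))) ⟨lab s (tp (k - 2 - n)), hlab_lt s _⟩ ⟨W n s, (hWval n (by omega) s).1⟩
        (fun h => hreal0 s n (by omega) h) (fun h => hreal3 s n (by omega) h) (fun h => hWreal0 n (by omega) s h) (fun h => hWreal3 n (by omega) s h)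
      simp only at hv
      rw [hv, hlab_red, ih (by omega) s, hmaj]
  -- (Id) monotonicity of W n along the colouring order
  have hWmono : ∀ n, n + 3 ≤ k → ∀ s t, le s t → leL (W n s) (W n t) = true := by
    intro n
    induction n with
    | zero => intro _ s t hst; rw [hW0, hW0]; rw [hle] at hst; exact hst _
    | succ n ih =>
      intro hn s t hst
      rw [hWs, hWs]
      have hst' := hst; rw [hle] at hst'
      have hv := hGmono (s («at» (k - 1 - n))) (t («at» (k - 1 - n))) ⟨lab s (tp (k - 2 - n)), hlab_lt s _⟩ ⟨W n s, (hWval n (by omega) s).1⟩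
        ⟨lab t (tp (k - 2 - n)), hlab_lt t _⟩ ⟨W n t, (hWval n (by omega) t).1⟩
        (hatom_mono s t hst (k - 1 - n) (by omega))
        (fun h => hreal0 s n (by omega) h) (fun h => hreal3 s n (by omega) h) (fun h => hWreal0 n (by omega) s h) (fun h => hWreal3 n (by omega) s h)
        (fun h => hreal0 t n (by omega) h) (fun h => hreal3 t n (by omega) h) (fun h => hWreal0 n (by omega) t h) (fun h => hWreal3 n (by omega) t h)
        (hst' _) (ih (by omega) s t hst)
      simpa using hv
  -- (Ie) ι-equivariance of W n
  have hWcpl : ∀ n, n + 3 ≤ k → ∀ s, W n (cpl s) = 3 - W n s := by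
    intro n
    induction n with
    | zero => intro _ s; rw [hW0, hW0, hlab_cpl]
    | succ n ih =>
      intro hn s
      rw [hWs, hWs, hlab_cpl, ih (by omega) s]
      have hv := hGcpl (s («at» (k - 1 - n))) ⟨lab s (tp (k - 2 - n)), hlab_lt s _⟩ ⟨W n s, (hWval n (by omega) s).1⟩
      simp only at hv
      rw [← hv]
  -- (If) cW n depends only on the path, (Ig) is self-dual, (Ih) is red on the all-red path
  have hcW_congr : ∀ n, n + 3 ≤ k → ∀ s t : E → Bool, (∀ e ∈ S, s e = t e) → cW n s = cW n t := by
    intro n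
    induction n with
    | zero => intro _ s t h; rw [hcW0, hcW0]; exact h _ (htpS (k - 1) (by omega) (by omega))
    | succ n ih =>
      intro hn s t h
      rw [hcWs, hcWs, ih (by omega) s t h, h _ (htpS (k - 2 - n) (by omega) (by omega)), h _ (hatS (k - 1 - n) (by omega) (by omega))]
  have hcW_cpl : ∀ n (s : E → Bool), cW n (fun e => !s e) = !cW n s := by
    intro n
    induction n with
    | zero => intro s; rw [hcW0, hcW0]
    | succ n ih =>
      intro s
      rw [hcWs, hcWs, ih s, hmaj]
      cases s (tp (k - 2 - n)) <;> cases s («at» (k - 1 - n)) <;> cases cW n s <;> rfl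
  have hcW_red : ∀ n, n + 3 ≤ k → ∀ s : E → Bool, (∀ e ∈ S, s e = true) → cW n s = true := by
    intro n
    induction n with
    | zero => intro _ s h; rw [hcW0]; exact h _ (htpS (k - 1) (by omega) (by omega))
    | succ n ih =>
      intro hn s h
      rw [hcWs, ih (by omega) s h, h _ (htpS (k - 2 - n) (by omega) (by omega)), hmaj]
      cases s («at» (k - 1 - n)) <;> rfl
  -- ### the virtual top: label ly = W (k-3), colour cy = cW (k-3)
  have hkk : k - 3 + 3 ≤ k := by omega
  refine AntitheticVirtualCrown.virtual_crown_obstruction down hdown lab hlab leL hleL le hle («at» 0) («at» 1) («at» 2) (tp 0) (tp 1)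
    (hmin 0 hk0) (hmin 1 (by omega)) (hmin 2 (by omega)) hax hbx hcx hbz hcz haz S D (cW (k - 3)) (W (k - 3))
    hSne haS hcS hSx hSz hSD haD hcD hbD hxD hzD (hcW_congr (k - 3) hkk) (hcW_cpl (k - 3)) (hcW_red (k - 3) hkk) ?_ (hWmono (k - 3) hkk)
  -- the defining equation of the virtual label
  intro s
  obtain ⟨hlt4, h0, h3⟩ := hWval (k - 3) hkk s
  have hred := hWred (k - 3) hkk s
  rw [← hD] at h0 h3
  by_cases hc : cW (k - 3) s = true
  · rw [if_pos hc]
    rw [hc, decide_eq_true_eq] at hred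
    by_cases hr : ∀ d ∈ D, s d = true
    · rw [if_pos hr]; exact h0.2 hr
    · rw [if_neg hr]; have := mt h0.1 hr; omega
  · rw [if_neg hc]
    have hc' : cW (k - 3) s = false := by simpa using hc
    rw [hc'] at hred
    have hge : ¬ W (k - 3) s < 2 := fun h => by rw [decide_eq_true h] at hred; exact Bool.noConfusion hred
    by_cases hb : ∀ d ∈ D, s d = false
    · rw [if_pos hb]; exact h3.2 hb
    · rw [if_neg hb]; have := mt h3.1 hb; omega

end AntitheticBetaCycleObstruction

end Summit.CriticalPhenomena.PercolationContinuityZ3.Theorems
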